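import Mathlib
import HarnessLib
import Summits.ResolutionOfSingularities.ResolutionOfSingularities.Theorems.WildQuotientsWildQuotientResolutionS1aModelNodeCentre

/-!
# S1a — X-scheme MOVE producer on an ABSTRACT model of a chart's node (K1′ supplied by the caller), and closedness of the centre from separating sections

[OURS · L1 W4.5c · lead-1 g13; plan-1 CHAIN v10.40 §4 ASSIGNMENT (ii) «split `a1_moves12` one theorem per move, consumers may take the node iso as
hypothesis», R-F15c (I-2 := MT-a1″), A-KF v1 §3.2] — NOT statements of the manuscript; counted 0; AI-level work, weaker than expert review. Crux
stmt-ResolutionOfSingularities-17941 `CyclicQuotientFourfolds`, line `s1a-logminvertex` v13 (`stub_reachLowerInFX`).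

The per-move theorems of an X-scheme instance are stated over an ABSTRACT ring `P` modelling the node of the chart that carries the next centre
(`Φ : DW.B ≃+* P`), so that no model-specific term (a localised polynomial ring spelled through all earlier moves) ever enters a statement; the
model-specific facts (K1′, units, characteristic) are discharged once, in the final assembly, from the free model. This file provides the two
node-generic inputs of such a move:
* `closure_zeroLocus_inter_subset_of_cover` — if `M.V` is covered by `W` and opens `U i`, and sections `t i ∈ Γ(M.V, W)` are units on `W ∩ U i` with a
  power in `S`, then the zero set of `S` on `W` is closed in `M.V` (its closure stays in `W`) — the `hcl` input below, discharged from chart-transition pins;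
* ★★ `GameFrame.GModel.exists_isAdmissibleCentre_of_node` — the twin of ✓`exists_isAdmissibleCentre_of_modelNode` (p672328) for an arbitrary model
  `Φ : DW.B ≃+* P` of the node `DW` of a stable affine chart `W` and an arbitrary homogeneous weighted centre `f : Fin c → P` which is K1′-REGULAR (`hK1`,
  `hK1'` — hypotheses), `σ`-adapted (`hσJ`) and has closed trace zero sets (`hcl`): a Veronese degree `d > 0` and an ADMISSIBLE `G`-stable centre `𝒦` on `M`
  with `W` a centre chart, `(𝒦|W)_n = e_P⁻¹(trace 𝒥ₙ(f, w))` and `supp 𝒦_d ⊆ W`.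
-/

set_option linter.dupNamespace false

noncomputable section

open CategoryTheory Limits AlgebraicGeometry TopologicalSpace Topology Opposite
open Literature.AlgebraicGeometry.Resolution Literature.AlgebraicGeometry.RelativeSpec
open Summit.ResolutionOfSingularities.ResolutionOfSingularities.Theorems.WildQuotientResolution.S1
open Summit.ResolutionOfSingularities.ResolutionOfSingularities.Theorems.WildQuotientResolution.S1.NodeAtlas
open Summit.ResolutionOfSingularities.ResolutionOfSingularities.Theorems.WildQuotientResolution.S1.ProducerStep
open Summit.ResolutionOfSingularities.ResolutionOfSingularities.Theorems.WildQuotientResolution.S1.CoarseChart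
open Summit.ResolutionOfSingularities.ResolutionOfSingularities.Theorems.WildQuotientResolution.S1.ChartData
open Summit.ResolutionOfSingularities.ResolutionOfSingularities.Theorems.WildQuotientResolution.S1.GoodCharts
open Summit.ResolutionOfSingularities.ResolutionOfSingularities.Theorems.WildQuotientResolution.S1.KillableTransport
open Summit.ResolutionOfSingularities.ResolutionOfSingularities.Theorems.WildQuotientResolution.S1.NodeTransport
open Summit.ResolutionOfSingularities.ResolutionOfSingularities.Theorems.WildQuotientResolution.S1.NpFrame

/-! ## Closedness of a zero set on a chart from separating sections -/

namespace Summit.ResolutionOfSingularities.ResolutionOfSingularities.Theorems.WildQuotientResolution.S1.GoodCharts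

universe u

/-- ★ **Separating sections make a chart's zero set closed in the ambient scheme.** `W` an open of `V`, opens `U i` with `V = W ∪ ⋃ U i`, sections
`t i ∈ Γ(V, W)` with `W ∩ U i ⊆ D(t i)` and some positive power of `t i` in `S ⊆ Γ(V, W)`: then `closure (V_W(S) ∩ W) ⊆ W`.
[OURS · L1 W4.5c · X-scheme, closedness input of the move producers; folklore] -/
theorem closure_zeroLocus_inter_subset_of_cover {V : Scheme.{u}} (W : V.Opens) {ι : Type*} (U : ι → V.Opens)
    (hcov : ∀ x : V, x ∈ W ∨ ∃ i, x ∈ U i) (S : Set Γ(V, W)) (t : ι → Γ(V, W))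
    (htS : ∀ i, ∃ n : ℕ, 0 < n ∧ t i ^ n ∈ S) (htU : ∀ i, ∀ v ∈ W, v ∈ U i → v ∈ V.basicOpen (t i)) :
    closure (V.zeroLocus (U := W) S ∩ (W : Set V)) ⊆ (W : Set V) := by
  intro x hx
  rcases hcov x with hxW | ⟨i, hxi⟩
  · exact hxW
  · exfalso
    obtain ⟨v, hvi, hvZ, hvW⟩ := mem_closure_iff.mp hx (U i) (U i).isOpen hxi
    obtain ⟨n, hn, hnS⟩ := htS i
    have hvt : v ∉ V.basicOpen (t i) := by
      have := (Scheme.mem_zeroLocus_iff _ _ _).mp hvZ _ hnS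
      rwa [Scheme.basicOpen_pow _ _ hn] at this
    exact hvt (htU i v hvW hvi)

end Summit.ResolutionOfSingularities.ResolutionOfSingularities.Theorems.WildQuotientResolution.S1.GoodCharts

/-! ## The move producer on an abstract model of a node -/

namespace Summit.ResolutionOfSingularities.ResolutionOfSingularities.Theorems.WildQuotientResolution.S1.GameFrame.GModel

variable {p : ℕ} {X' X₁ : Scheme.{0}} {q : X' ⟶ X₁} {G : Type} [Group G] {ρ : G →* Aut X'} {g₀ : G}

/-- ★★ **AN ADMISSIBLE CENTRE FROM A K1′ σ-ADAPTED HOMOGENEOUS WEIGHTED CENTRE IN AN ABSTRACT MODEL OF A CHART'S NODE.** `M` a separated model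
(`G = ⟨g₀⟩` finite), `W` a stable affine chart with node `DW` and a ring isomorphism `Φ : DW.B ≃+* P` onto ANY ring `P`; the centre `f : Fin c → P`
(`c > 0`) is homogeneous of degrees `δ` for the transported grading `Φ(DW.𝒜 ·)`, has weights `w > 0`, is K1′-regular (`hK1`, `hK1'`), is `σ`-adapted for
`σ_P = Φ⁻¹ ≫ DW.σ ≫ Φ` (`hσJ`), and the zero sets on `W` of the traces `e_P⁻¹(trace 𝒥ₙ)` (`e_P = DW.e ≫ Φ|₀`) are CLOSED in `M.V` (`hcl`). Then there
are a Veronese degree `d > 0` and an ADMISSIBLE centre `𝒦` on `M` with `W` a centre chart, `G`-stable pieces, `(𝒦|W)_n = e_P⁻¹(trace 𝒥ₙ(f, w))` and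
`supp 𝒦_d ⊆ W`. [OURS · L1 W4.5c · X-scheme MOVE producer for later moves, abstract-model form; NOT a statement of the manuscript] -/
theorem exists_isAdmissibleCentre_of_node [Finite G] (hG : ∀ g : G, g ∈ Subgroup.zpowers g₀) (M : GModel p q G ρ g₀) [M.V.IsSeparated]
    (W : M.act.StableAffineOpens) (DW : NodeData p M.act g₀ W)
    {P : Type} [CommRing P] (Φ : letI := DW.instCommRing; DW.B ≃+* P)
    {c : ℕ} (hc : 0 < c) (f : Fin c → P) (δ : Fin c → Π j : Fin DW.m, ZMod (DW.r j)) (w : Fin c → ℕ) (hw : ∀ i, 0 < w i)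
    (hdeg : ∀ i, letI := DW.instCommRing; letI := DW.instGradedRing; f i ∈ mapGrading DW.𝒜 Φ (δ i))
    (hK1 : RingTheory.Sequence.IsRegular P (List.ofFn f)) (hK1' : IsRegularRing (P ⧸ Ideal.span (Set.range f)))
    (hσJ : letI := DW.instCommRing; ∀ n : ℕ,
      ((weightedFiltration f w).ideal n).map (conj Φ DW.σ : P →+* P) ≤ (weightedFiltration f w).ideal n)
    (hcl : letI := DW.instCommRing; letI := DW.instGradedRing; letI := mapGradedRing DW.𝒜 Φ; ∀ n : ℕ, 0 < n →
      closure (M.V.zeroLocus (U := W.1)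
          ((((traceFiltration (mapGrading DW.𝒜 Φ) f w).ideal n).comap
              ((DW.e.trans (zeroRingEquiv DW.𝒜 Φ) : Γ(M.V, W.1) ≃+* ↥(mapGrading DW.𝒜 Φ 0)) : Γ(M.V, W.1) →+* ↥(mapGrading DW.𝒜 Φ 0)) :
            Ideal Γ(M.V, W.1)) : Set Γ(M.V, W.1)) ∩ (W.1 : Set M.V)) ⊆ (W.1 : Set M.V)) :
    letI := DW.instCommRing; letI := DW.instGradedRing; letI := mapGradedRing DW.𝒜 Φ
    ∃ (𝒦 : ReesFiltration M.V) (d : ℕ), 0 < d ∧ IsAdmissibleCentre p M.act g₀ 𝒦 d ∧ IsCentreChart p M.act g₀ 𝒦 d W ∧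
      (∀ (g : G) (n : ℕ), (𝒦.ideal n).comap (M.act.aut g).hom = 𝒦.ideal n) ∧
      (∀ n, (𝒦.filtration ⟨W.1, DW.affine⟩).ideal n =
        ((traceFiltration (mapGrading DW.𝒜 Φ) f w).ideal n).comap
          ((DW.e.trans (zeroRingEquiv DW.𝒜 Φ) : Γ(M.V, W.1) ≃+* ↥(mapGrading DW.𝒜 Φ 0)) : Γ(M.V, W.1) →+* ↥(mapGrading DW.𝒜 Φ 0))) ∧
      VeroneseNormalised (mapGrading DW.𝒜 Φ) f w d ∧
      (((𝒦.ideal d).support : Set M.V)) ⊆ (W.1 : Set M.V) := by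
  classical
  letI := DW.instCommRing
  letI := DW.instGradedRing
  letI := mapGradedRing DW.𝒜 Φ
  haveI : IsLocallyNoetherian M.V := M.isLocallyNoetherian
  set eL : Γ(M.V, W.1) ≃+* ↥(mapGrading DW.𝒜 Φ 0) := DW.e.trans (zeroRingEquiv DW.𝒜 Φ) with heL
  -- the transported node
  have htame : IsTameNode p P (mapGrading DW.𝒜 Φ) (conj Φ DW.σ) := isTameNode_map DW.𝒜 Φ p DW.σ DW.tame
  have hσ : ∀ t : Γ(M.V, W.1), ((eL ((M.act.aut g₀⁻¹).hom.appLE W.1 W.1 (W.2.1 g₀⁻¹).ge t) : ↥(mapGrading DW.𝒜 Φ 0)) : P) =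
      conj Φ DW.σ ((eL t : ↥(mapGrading DW.𝒜 Φ 0)) : P) := fun t => by
    change Φ ((DW.e (actO M.act W g₀ t) : ↥(DW.𝒜 0)) : DW.B) = Φ (DW.σ (Φ.symm (Φ ((DW.e t : ↥(DW.𝒜 0)) : DW.B))))
    rw [DW.intertwine t, Φ.symm_apply_apply]
  -- a Veronese degree
  obtain ⟨d, hver⟩ : ∃ d : ℕ, VeroneseNormalised (mapGrading DW.𝒜 Φ) f w d :=
    Veronese.veroneseNormalisation _ _ (mapGrading DW.𝒜 Φ) htame.2.2.2.1 c f δ w hdeg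
  have hdpos : 0 < d := hver.1
  -- the chart filtration and its trace
  let K : IdealFiltration Γ(M.V, W.1) := (traceFiltration (mapGrading DW.𝒜 Φ) f w).comap (eL : Γ(M.V, W.1) →+* ↥(mapGrading DW.𝒜 Φ 0))
  let 𝒦₀ : ReesFiltration M.V := chartFiltration W.1 K
  have h𝒦O : ∀ n, (𝒦₀.filtration ⟨W.1, DW.affine⟩).ideal n =
      ((traceFiltration (mapGrading DW.𝒜 Φ) f w).ideal n).comap (eL : Γ(M.V, W.1) →+* ↥(mapGrading DW.𝒜 Φ 0)) := fun n => by
    rw [filtration_chartFiltration W.1 DW.affine K n]; rfl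
  have hcentre : IsCentreChart p M.act g₀ 𝒦₀ d W :=
    ⟨DW.affine, DW.m, DW.r, P, inferInstance, mapGrading DW.𝒜 Φ, inferInstance, conj Φ DW.σ, eL, htame, hσ, c, f, δ, w, hc, hdeg, hw,
      hK1, hK1', hσJ, h𝒦O, hver⟩
  -- closedness of the support on the chart
  have hsupp : (((𝒦₀.ideal d).support : Set M.V)) = closure (M.V.zeroLocus (U := W.1) ((K.ideal d : Ideal Γ(M.V, W.1)) : Set Γ(M.V, W.1)) ∩ (W.1 : Set M.V)) :=
    support_chartFiltration W.1 DW.affine K d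
  have hclW : closure (M.V.zeroLocus (U := W.1) ((K.ideal d : Ideal Γ(M.V, W.1)) : Set Γ(M.V, W.1)) ∩ (W.1 : Set M.V)) ⊆ (W.1 : Set M.V) := hcl d hdpos
  have hcl' : ∀ _ : Unit, closure ((((𝒦₀.ideal d).support : Set M.V)) ∩ (W.1 : Set M.V)) ⊆ ⋃ _ : Unit, (W.1 : Set M.V) := fun _ => by
    rw [Set.iUnion_const, hsupp]
    refine (closure_mono Set.inter_subset_left).trans ?_
    rw [closure_closure]
    exact hclW
  obtain ⟨J, hJadm, hJO, hJG, hJfil, hJsub, -⟩ := exists_isAdmissibleCentre_of_charts hG M (fun _ : Unit => W) (fun _ => 𝒦₀) hdpos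
    (fun _ => hcentre) (fun _ _ _ _ _ _ => rfl) hcl'
  refine ⟨J, d, hdpos, hJadm, hJO (), hJG, fun n => by rw [hJfil () DW.affine n, h𝒦O], hver, hJsub.trans ?_⟩
  rw [Set.iUnion_const, hsupp]
  refine (closure_mono Set.inter_subset_left).trans ?_
  rw [closure_closure]
  exact hclW

end Summit.ResolutionOfSingularities.ResolutionOfSingularities.Theorems.WildQuotientResolution.S1.GameFrame.GModel

end
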